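import Mathlib
import Summits.Ventures.PercRepro2.SwAllLeafMarkDefs

/-!
# THE MARK AT A LEAF, II: row 2′SW-ALL with the mark at a pendant vertex from the row with the
mark at its neighbour (blind cell PercRepro2, night-4 g27, 2026-08-28; proofs/NIGHT4-G27.md §12)

With `x` a leaf at `p`, `x ≠ l, h`: the side `Q_x = {e red, h ∉ H_l, p ∈ C_R(l)}` splits into
`A = Q_p ∩ {e red}` (`p ∉ C_B(l)`) and `B` (`p ∈ C_B(l)`).  On `A` the rigid counting inequality
follows from that of `Q_p` (`card_le_of_swAll`) with the up-set `{S | S ∖ {e} ∈ 𝓔}`: the red-`e`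
part of `Q_p` IS `A` (`mem_partA_iff`) and its blue-`e` part is in bijection with `A` through
opening the leaf edge (`update_mem_tgt_p`, `redEdges_update_of_mem_tgt_p`, `blueEdges_update_true`,
`blueEdges_eq_sdiff_update_false`), so both counts of `Q_p` are twice those of `A`; on `B` the
colour swap with `e` kept red is a bijection exchanging the two edge sets (SwAllLeafMarkDefs).
Hence **`IsLeafAt.card_le_leafMark`**, and by Hall (`exists_swAll_injection_of_card_le`)
**`IsLeafAt.swAll_leafMark : SwAll ends l h p → SwAll ends l h x`** and `IsLeafAt.sw_leafMark`.
Coverage (mining/night-4/g27/coverage.py, the `markpiece` line): a mark hanging as a leaf at a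
dropped vertex of a cross junction — +2.5 points of the (graph, marking) pairs at n = 7.
-/

namespace Summit.Ventures.PercRepro2

namespace LocRows

open Hull

variable {V : Type*} {E : Type*}

section PartA

variable [Fintype E] [DecidableEq E]

open scoped Classical

variable {ends : E → Sym2 V} {x p : V} {e : E} (hleaf : IsLeafAt ends x p e) {l h : V}
  (hxl : x ≠ l) (hxh : x ≠ h)
include hleaf hxl

/-- **The part `A` of the side of the leaf is the red-`e` part of the side of `p`.** -/
lemma IsLeafAt.mem_partA_iff {ζ : Config E} :
    (ζ ∈ tgtU ends l h {S : Set V | x ∈ S} ∧ p ∉ cluster ends (blue ζ) l) ↔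
      (ζ ∈ tgtU ends l h {S : Set V | p ∈ S} ∧ ζ e = true) := by
  rw [hleaf.mem_tgt_leaf_iff hxl, mem_tgt_iff]
  tauto

omit hxl in
/-- On the side of `p`, the leaf edge is not a red edge of `h`. -/
lemma IsLeafAt.leaf_notMem_redEdges {ζ : Config E} (hζ : ζ ∈ tgtU ends l h {S : Set V | p ∈ S}) :
    e ∉ redEdges ends ζ h := by
  rw [mem_tgt_iff] at hζ
  rintro ⟨-, h2⟩
  exact hleaf.leaf_edge_notMem_within (notMem_cluster_h_of_mem_cluster_l hζ.1 hζ.2.1) h2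

omit hleaf hxl [Fintype E] [DecidableEq E] in
/-- An edge not in a set is removed from it vacuously. -/
lemma sdiff_singleton_of_notMem {S : Set E} (he : e ∉ S) : S \ {e} = S := by
  ext e'
  simp only [Set.mem_sdiff, Set.mem_singleton_iff, and_iff_left_iff_imp]
  rintro h' rfl
  exact he h'

include hxh in
/-- **Flipping the leaf edge keeps the side of `p`.** -/
lemma IsLeafAt.update_mem_tgt_p {ζ : Config E} (hζ : ζ ∈ tgtU ends l h {S : Set V | p ∈ S})
    (b : Bool) : Function.update ζ e b ∈ tgtU ends l h {S : Set V | p ∈ S} := by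
  rw [mem_tgt_iff] at hζ ⊢
  obtain ⟨hh, hpR, hpB⟩ := hζ
  have hlx : l ≠ x := hxl.symm
  have hpx : p ≠ x := fun h' => hleaf.up h'.symm
  have hag : ∀ e', e' ≠ e → Function.update ζ e b e' = ζ e' := fun e' hee => Function.update_of_ne hee _ _
  have hag' : ∀ e', e' ≠ e → blue (Function.update ζ e b) e' = blue ζ e' := by
    intro e' hee
    rw [blue_update, Function.update_of_ne hee]
  refine ⟨?_, ?_, ?_⟩
  · rintro (h1 | h1)
    · exact hh (Or.inl (hleaf.mem_cluster_of_agree_off_leaf hag hlx hxh.symm h1))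
    · exact hh (Or.inr (hleaf.mem_cluster_of_agree_off_leaf hag' hlx hxh.symm h1))
  · exact hleaf.mem_cluster_of_agree_off_leaf (fun e' hee => (hag e' hee).symm) hlx hpx hpR
  · intro h1
    exact hpB (hleaf.mem_cluster_of_agree_off_leaf hag' hlx hpx h1)

include hxh in
/-- **The red edge set of `h` ignores the leaf edge on the side of `p`.** -/
lemma IsLeafAt.redEdges_update_of_mem_tgt_p {ζ : Config E}
    (hζ : ζ ∈ tgtU ends l h {S : Set V | p ∈ S}) (b : Bool) :
    redEdges ends (Function.update ζ e b) h = redEdges ends ζ h := by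
  have hζ' := hleaf.update_mem_tgt_p hxl hxh hζ b
  rw [mem_tgt_iff] at hζ hζ'
  exact (hleaf.redEdges_eq_of_agree_off_leaf hxh (fun e' hee => (Function.update_of_ne hee _ _).symm)
    (notMem_cluster_h_of_mem_cluster_l hζ.1 hζ.2.1)
    (notMem_cluster_h_of_mem_cluster_l hζ'.1 hζ'.2.1)).symm

omit hxl [Fintype E] in
include hxh in
/-- **Opening the leaf edge removes it from the blue edge set of `h`.** -/
lemma IsLeafAt.blueEdges_update_true (ζ : Config E) :
    blueEdges ends (Function.update ζ e true) h = blueEdges ends ζ h \ {e} := by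
  rw [blueEdges, blueEdges, blue_update]
  exact hleaf.redEdges_eq_sdiff_of_agree_off_leaf hxh
    (fun e' hee => (Function.update_of_ne hee _ _).symm) (by simp)

omit hxl [Fintype E] in
include hxh in
/-- **Closing a red leaf edge adds nothing but itself to the blue edge set of `h`.** -/
lemma IsLeafAt.blueEdges_eq_sdiff_update_false {ζ : Config E} (he : ζ e = true) :
    blueEdges ends ζ h = blueEdges ends (Function.update ζ e false) h \ {e} := by
  rw [blueEdges, blueEdges, blue_update]
  refine hleaf.redEdges_eq_sdiff_of_agree_off_leaf hxh
    (fun e' hee => Function.update_of_ne hee _ _) ?_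
  simp [blue, he]

end PartA

section Theorem

variable [Fintype E] [DecidableEq E]

open scoped Classical

variable {ends : E → Sym2 V} {x p : V} {e : E} (hleaf : IsLeafAt ends x p e) {l h : V}
  (hxl : x ≠ l) (hxh : x ≠ h)
include hleaf hxl hxh

/-- **The rigid counting inequality on the side of the leaf** from row 2′SW-ALL with the mark at
its neighbour. -/
theorem IsLeafAt.card_le_leafMark (hp : SwAll ends l h p) (𝓔 : Set (Set E)) (h𝓔 : IsUpperSet 𝓔) :
    ((tgtU ends l h {S : Set V | x ∈ S}).filter fun ζ => redEdges ends ζ h ∈ 𝓔).card ≤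
      ((tgtU ends l h {S : Set V | x ∈ S}).filter fun ζ => blueEdges ends ζ h ∈ 𝓔).card := by
  set Qx := tgtU ends l h {S : Set V | x ∈ S} with hQx
  set Qp := tgtU ends l h {S : Set V | p ∈ S} with hQp
  set SR := Qx.filter fun ζ => redEdges ends ζ h ∈ 𝓔 with hSR
  set SB := Qx.filter fun ζ => blueEdges ends ζ h ∈ 𝓔 with hSB
  have hsplitR := Finset.card_filter_add_card_filter_not
    (s := SR) (p := fun ζ => p ∈ cluster ends (blue ζ) l)
  have hsplitB := Finset.card_filter_add_card_filter_not
    (s := SB) (p := fun ζ => p ∈ cluster ends (blue ζ) l)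
  -- part B: the swap with `e` kept red
  have hB : (SR.filter fun ζ => p ∈ cluster ends (blue ζ) l).card =
      (SB.filter fun ζ => p ∈ cluster ends (blue ζ) l).card := by
    refine Finset.card_bij' (fun ζ _ => swapKeep e ζ) (fun ζ _ => swapKeep e ζ) ?_ ?_ ?_ ?_
    · intro ζ hζ
      simp only [hSR, hSB, Finset.mem_filter] at hζ ⊢
      obtain ⟨⟨hQ, hR⟩, hq⟩ := hζ
      obtain ⟨hQ', hq'⟩ := hleaf.swapKeep_mem hxl hxh hQ hq
      refine ⟨⟨hQ', ?_⟩, hq'⟩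
      rw [(hleaf.redEdges_swapKeep hxl hxh hQ hq).2]
      exact hR
    · intro ζ hζ
      simp only [hSR, hSB, Finset.mem_filter] at hζ ⊢
      obtain ⟨⟨hQ, hBl⟩, hq⟩ := hζ
      obtain ⟨hQ', hq'⟩ := hleaf.swapKeep_mem hxl hxh hQ hq
      refine ⟨⟨hQ', ?_⟩, hq'⟩
      rw [(hleaf.redEdges_swapKeep hxl hxh hQ hq).1]
      exact hBl
    · intro ζ hζ
      simp only [hSR, Finset.mem_filter] at hζ
      have he : ζ e = true := ((hleaf.mem_tgt_leaf_iff hxl).1 hζ.1.1).2.1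
      exact swapKeep_swapKeep he
    · intro ζ hζ
      simp only [hSB, Finset.mem_filter] at hζ
      have he : ζ e = true := ((hleaf.mem_tgt_leaf_iff hxl).1 hζ.1.1).2.1
      exact swapKeep_swapKeep he
  -- part A: the inequality of the side of `p` with the up-set `{S | S ∖ {e} ∈ 𝓔}`
  have hA : (SR.filter fun ζ => ¬ p ∈ cluster ends (blue ζ) l).card ≤
      (SB.filter fun ζ => ¬ p ∈ cluster ends (blue ζ) l).card := by
    let 𝓔' : Set (Set E) := {S | S \ {e} ∈ 𝓔}
    have h𝓔' : IsUpperSet 𝓔' := fun S T hST hS => h𝓔 (Set.sdiff_subset_sdiff_left hST) hS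
    set TR := Qp.filter fun ζ => redEdges ends ζ h ∈ 𝓔' with hTR
    set TB := Qp.filter fun ζ => blueEdges ends ζ h ∈ 𝓔' with hTB
    have hineq : TR.card ≤ TB.card := by
      have h0 := card_le_of_swAll (l := l) (h := h) hp 𝓔' h𝓔'
      rw [hTR, hTB, hQp]
      convert h0 using 4
    have hsR := Finset.card_filter_add_card_filter_not (s := TR) (p := fun ζ => ζ e = true)
    have hsB := Finset.card_filter_add_card_filter_not (s := TB) (p := fun ζ => ζ e = true)
    -- the red-`e` parts are the parts `A`
    have eR1 : TR.filter (fun ζ => ζ e = true) = SR.filter fun ζ => ¬ p ∈ cluster ends (blue ζ) l := by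
      ext ζ
      simp only [hTR, hSR, Finset.mem_filter]
      constructor
      · rintro ⟨⟨hQ, hR⟩, he⟩
        have hA' := (hleaf.mem_partA_iff hxl).2 ⟨hQ, he⟩
        refine ⟨⟨hA'.1, ?_⟩, hA'.2⟩
        have : redEdges ends ζ h \ {e} ∈ 𝓔 := hR
        rwa [sdiff_singleton_of_notMem (hleaf.leaf_notMem_redEdges hQ)] at this
      · rintro ⟨⟨hQ, hR⟩, hq⟩
        have hA' := (hleaf.mem_partA_iff hxl).1 ⟨hQ, hq⟩
        refine ⟨⟨hA'.1, ?_⟩, hA'.2⟩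
        show redEdges ends ζ h \ {e} ∈ 𝓔
        rwa [sdiff_singleton_of_notMem (hleaf.leaf_notMem_redEdges hA'.1)]
    have eB1 : TB.filter (fun ζ => ζ e = true) = SB.filter fun ζ => ¬ p ∈ cluster ends (blue ζ) l := by
      ext ζ
      simp only [hTB, hSB, Finset.mem_filter]
      have hnot : ∀ ζ' : Config E, ζ' e = true → e ∉ blueEdges ends ζ' h := by
        intro ζ' he' hmem
        have := hmem.1
        rw [blue_eq_true_iff, he'] at this
        exact Bool.noConfusion this
      constructor
      · rintro ⟨⟨hQ, hBl⟩, he⟩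
        have hA' := (hleaf.mem_partA_iff hxl).2 ⟨hQ, he⟩
        refine ⟨⟨hA'.1, ?_⟩, hA'.2⟩
        have : blueEdges ends ζ h \ {e} ∈ 𝓔 := hBl
        rwa [sdiff_singleton_of_notMem (hnot ζ he)] at this
      · rintro ⟨⟨hQ, hBl⟩, hq⟩
        have hA' := (hleaf.mem_partA_iff hxl).1 ⟨hQ, hq⟩
        refine ⟨⟨hA'.1, ?_⟩, hA'.2⟩
        show blueEdges ends ζ h \ {e} ∈ 𝓔
        rwa [sdiff_singleton_of_notMem (hnot ζ hA'.2)]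
    -- the blue-`e` parts are in bijection with the parts `A` through opening the leaf edge
    have eR2 : (TR.filter fun ζ => ¬ ζ e = true).card =
        (SR.filter fun ζ => ¬ p ∈ cluster ends (blue ζ) l).card := by
      refine Finset.card_bij' (fun ζ _ => Function.update ζ e true)
        (fun ζ _ => Function.update ζ e false) ?_ ?_ ?_ ?_
      · intro ζ hζ
        simp only [hTR, hSR, Finset.mem_filter] at hζ ⊢
        obtain ⟨⟨hQ, hR⟩, -⟩ := hζ
        have hQ' := hleaf.update_mem_tgt_p hxl hxh hQ true
        have hA' := (hleaf.mem_partA_iff hxl).2 ⟨hQ', by simp⟩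
        refine ⟨⟨hA'.1, ?_⟩, hA'.2⟩
        rw [hleaf.redEdges_update_of_mem_tgt_p hxl hxh hQ]
        have : redEdges ends ζ h \ {e} ∈ 𝓔 := hR
        rwa [sdiff_singleton_of_notMem (hleaf.leaf_notMem_redEdges hQ)] at this
      · intro ζ hζ
        simp only [hTR, hSR, Finset.mem_filter] at hζ ⊢
        obtain ⟨⟨hQ, hR⟩, hq⟩ := hζ
        have hA' := (hleaf.mem_partA_iff hxl).1 ⟨hQ, hq⟩
        have hQ' := hleaf.update_mem_tgt_p hxl hxh hA'.1 false
        refine ⟨⟨hQ', ?_⟩, by simp⟩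
        show redEdges ends (Function.update ζ e false) h \ {e} ∈ 𝓔
        rw [hleaf.redEdges_update_of_mem_tgt_p hxl hxh hA'.1,
          sdiff_singleton_of_notMem (hleaf.leaf_notMem_redEdges hA'.1)]
        exact hR
      · intro ζ hζ
        simp only [hTR, Finset.mem_filter, Bool.not_eq_true] at hζ
        rw [Function.update_idem, ← hζ.2]
        exact Function.update_eq_self e ζ
      · intro ζ hζ
        simp only [hSR, Finset.mem_filter] at hζ
        have he : ζ e = true := ((hleaf.mem_tgt_leaf_iff hxl).1 hζ.1.1).2.1
        rw [Function.update_idem, ← he]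
        exact Function.update_eq_self e ζ
    have eB2 : (TB.filter fun ζ => ¬ ζ e = true).card =
        (SB.filter fun ζ => ¬ p ∈ cluster ends (blue ζ) l).card := by
      refine Finset.card_bij' (fun ζ _ => Function.update ζ e true)
        (fun ζ _ => Function.update ζ e false) ?_ ?_ ?_ ?_
      · intro ζ hζ
        simp only [hTB, hSB, Finset.mem_filter] at hζ ⊢
        obtain ⟨⟨hQ, hBl⟩, -⟩ := hζ
        have hQ' := hleaf.update_mem_tgt_p hxl hxh hQ true
        have hA' := (hleaf.mem_partA_iff hxl).2 ⟨hQ', by simp⟩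
        refine ⟨⟨hA'.1, ?_⟩, hA'.2⟩
        rw [hleaf.blueEdges_update_true hxh]
        exact hBl
      · intro ζ hζ
        simp only [hTB, hSB, Finset.mem_filter] at hζ ⊢
        obtain ⟨⟨hQ, hBl⟩, hq⟩ := hζ
        have hA' := (hleaf.mem_partA_iff hxl).1 ⟨hQ, hq⟩
        have hQ' := hleaf.update_mem_tgt_p hxl hxh hA'.1 false
        refine ⟨⟨hQ', ?_⟩, by simp⟩
        show blueEdges ends (Function.update ζ e false) h \ {e} ∈ 𝓔
        rw [← hleaf.blueEdges_eq_sdiff_update_false hxh hA'.2]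
        exact hBl
      · intro ζ hζ
        simp only [hTB, Finset.mem_filter, Bool.not_eq_true] at hζ
        rw [Function.update_idem, ← hζ.2]
        exact Function.update_eq_self e ζ
      · intro ζ hζ
        simp only [hSB, Finset.mem_filter] at hζ
        have he : ζ e = true := ((hleaf.mem_tgt_leaf_iff hxl).1 hζ.1.1).2.1
        rw [Function.update_idem, ← he]
        exact Function.update_eq_self e ζ
    rw [eR1] at hsR
    rw [eB1] at hsB
    omega
  omega

/-- **THE MARK AT A LEAF**: row 2′SW-ALL with the mark at a pendant vertex `x ≠ l, h` follows
from the row with the mark at its neighbour `p`. -/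
theorem IsLeafAt.swAll_leafMark (hp : SwAll ends l h p) : SwAll ends l h x :=
  exists_swAll_injection_of_card_le h _ (hleaf.card_le_leafMark hxl hxh hp)

/-- **Row (SW) with the mark at a leaf** from row 2′SW-ALL with the mark at its neighbour. -/
theorem IsLeafAt.sw_leafMark (hp : SwAll ends l h p) : Sw ends l h x :=
  sw_of_swAll ends (hleaf.swAll_leafMark hxl hxh hp)

end Theorem

end LocRows

end Summit.Ventures.PercRepro2
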